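import Summits.QuantumFields.YangMills.Theorems.FlatTubeReductionUpStepCertificate
import HarnessLib

/-!
# Route `FlatTubeReduction` — `Assembly2` (UpStepEv architecture), the proved assembly item

Planner glue (seat ym-idea-1 g5, 2026-08-28).  R2b1 is a RECORD rung (`FemtoGapOfRecord`) — not infinite volume, not the Clay gap, no summit;
the theorem is an implication from OPEN route items.

`Assembly2 : NearFlatRatioLaw → OctaveStepDecay → UpStepEv → FemtoGapOfRecord` (stmt-QuantumFields-27073) is exactly the certificate
`femtoGapOfRecord_of_nearFlatRatioLaw_octave_upStep` of ym-line-fcl-p3 (p617982): K2 `OffTubeSuppression` is the theorem `offTubeSuppression_proof`,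
the fixed-lattice leaf comes from K1 by `femtoGapFixedLattice_of_nearFlatRatioLaw`, and the incommensurable leg is the shared VARIATIONAL step
`UpStepEv` (stmt-QuantumFields-26796; this route's decl is definitionally FemtoCutoffLadder's).  With it the route's deciding theorem can read
`closes (h₁ : NearFlatRatioLaw) (h₃ : OctaveStepDecay) (hU : UpStepEv) (h₆ : Assembly2) := h₆ h₁ h₃ hU`.
-/

set_option autoImplicit false

namespace Summit.QuantumFields.YangMills.Theorems.FlatTubeReduction

open Summit.QuantumFields.YangMills.Theses.FlatTubeReduction

/-- **`Assembly2` holds** (route FlatTubeReduction, UpStepEv architecture): `NearFlatRatioLaw → OctaveStepDecay → UpStepEv → FemtoGapOfRecord`,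
by the landed certificate `femtoGapOfRecord_of_nearFlatRatioLaw_octave_upStep` (this route's `UpStepEv` unfolds to its hypothesis verbatim).
[cite: LuscherWeiszWolff1991] -/
theorem assembly2_proof : Summit.QuantumFields.YangMills.Theses.FlatTubeReduction.Assembly2 :=
  fun h₁ h₃ hU => femtoGapOfRecord_of_nearFlatRatioLaw_octave_upStep h₁ h₃ (by exact hU)

end Summit.QuantumFields.YangMills.Theorems.FlatTubeReduction
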